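import Summits.PneNP.PneNP.Theorems.ConvexRankGatesCaptureTJoinGate
import Mathlib.LinearAlgebra.Span.Defs
import Mathlib.LinearAlgebra.Pi
import Mathlib.Data.ZMod.Basic
import HarnessLib

/-!
# Crux `Capture` (stmt-PneNP-2659) — GRAPHIC `𝔽₂`-SPAN MEMBERSHIP is ONE GRANK gate

The bridge from the pairing form of `pairConnected_isGRankGate` to the vocabulary of the abelian PERM /
XOR-SAT door (`𝔽₂`-span membership of a fixed vector in the span of the SELECTED vectors): for an edge list
`(p i, q i)` and terminals `τ : Fin k → V`,

  `∃ good pairing of the terminals through selected paths  ↔  Σ_j e_{τ j} ∈ span_{𝔽₂} {e_{p i} + e_{q i} : v i = 1}`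

(`pairing_iff_mem_span`; `→`: a selected walk telescopes `e_a + e_b` into selected edge vectors, and a
fixed-point-free involution splits `Σ_j e_{τ j}` into its pairs; `←`: the parity functional of a connectivity
class kills every selected edge vector, hence the span, so every class holds an even number of terminals
and `exists_perm_pairing_of_even_fibers` pairs them). Consequently (`graphicSpan_isGRankGate`) the
monotone function `v ↦ [Σ_j e_{τ j} ∈ span_{𝔽₂} {e_{p i} + e_{q i} : v i = 1}]` — span membership for
GRAPHIC vectors, i.e. `T`-join existence / Tseitin satisfiability by selected edges — is ONE GRANK gate of
dimension `|V|(|V|+1)k + k`. The non-graphic case (vectors of weight `≥ 3`, the `ℤ/2^k` third door) stays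
open. [folklore]
-/

namespace Summit.PneNP.PneNP.Theorems.Capture.TJoin

set_option linter.dupNamespace false -- `Summit.PneNP.PneNP.…`: summit = sub-problem (D-0017)

open Matrix Finset Literature.Computability.Complexity

noncomputable section

variable {V : Type} [Fintype V] [DecidableEq V] {n k : ℕ}

/-! ### Pairing ⇒ span -/

omit [Fintype V] in
/-- In characteristic two `e_a + e_a = 0`. [folklore] -/
theorem single_add_single_self (a : V) :
    (Pi.single a (1 : ZMod 2) + Pi.single a 1 : V → ZMod 2) = 0 := by
  ext u
  simp only [Pi.add_apply, Pi.single_apply, Pi.zero_apply]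
  split_ifs <;> decide

omit [Fintype V] in
/-- **A selected walk telescopes**: if `a` and `b` are joined by a walk of selected edges then `e_a + e_b` lies
in the `𝔽₂`-span of the selected edge vectors. [folklore] -/
theorem single_add_single_mem_span_of_walk (p q : Fin n → V) (v : Fin n → Bool) :
    ∀ {a b : V} (W : (SimpleGraph.fromRel fun a b : V => ∃ i, v i = true ∧ p i = a ∧ q i = b).Walk a b),
      (Pi.single a (1 : ZMod 2) + Pi.single b 1 : V → ZMod 2) ∈
        Submodule.span (ZMod 2) ((fun i => (Pi.single (p i) (1 : ZMod 2) + Pi.single (q i) 1 : V → ZMod 2)) ''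
          {i | v i = true}) := by
  intro a b W
  induction W with
  | nil =>
      rw [single_add_single_self]
      exact Submodule.zero_mem _
  | @cons a c b hadj W ih =>
      have hsplit : (Pi.single a (1 : ZMod 2) + Pi.single b 1 : V → ZMod 2) =
          (Pi.single a 1 + Pi.single c 1) + (Pi.single c 1 + Pi.single b 1) := by
        rw [add_assoc, ← add_assoc (Pi.single c (1 : ZMod 2) : V → ZMod 2) (Pi.single c 1) (Pi.single b 1),
          single_add_single_self, zero_add]
      rw [hsplit]
      refine Submodule.add_mem _ ?_ ih
      rw [SimpleGraph.fromRel_adj] at hadj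
      obtain ⟨-, ⟨i, hvi, h1, h2⟩ | ⟨i, hvi, h1, h2⟩⟩ := hadj
      · refine Submodule.subset_span ⟨i, hvi, ?_⟩
        simp only [h1, h2]
      · refine Submodule.subset_span ⟨i, hvi, ?_⟩
        simp only [h1, h2, add_comm]

omit [Fintype V] in
/-- **Pairing ⇒ span**: a fixed-point-free involution of the terminals with selected-connected pairs puts
`Σ_j e_{τ j}` in the span of the selected edge vectors. [folklore] -/
theorem sum_single_mem_span_of_pairing (p q : Fin n → V) (τ : Fin k → V) (v : Fin n → Bool)
    (σ : Equiv.Perm (Fin k)) (h1 : ∀ j, σ j ≠ j) (h2 : ∀ j, σ (σ j) = j)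
    (h3 : ∀ j, (SimpleGraph.fromRel fun a b : V => ∃ i, v i = true ∧ p i = a ∧ q i = b).Reachable
      (τ j) (τ (σ j))) :
    (∑ j, Pi.single (τ j) (1 : ZMod 2) : V → ZMod 2) ∈
      Submodule.span (ZMod 2) ((fun i => (Pi.single (p i) (1 : ZMod 2) + Pi.single (q i) 1 : V → ZMod 2)) ''
        {i | v i = true}) := by
  classical
  -- split the sum over `{j < σ j}` and its image under `σ`
  set A := Finset.univ.filter fun j : Fin k => j < σ j with hA
  set B := Finset.univ.filter fun j : Fin k => σ j < j with hB
  have hdisj : Disjoint A B := by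
    rw [Finset.disjoint_filter]
    intro j _ h h'
    exact lt_asymm h h'
  have hunion : A ∪ B = Finset.univ := by
    ext j
    simp only [hA, hB, Finset.mem_union, Finset.mem_filter, Finset.mem_univ, true_and, iff_true]
    rcases lt_trichotomy j (σ j) with hlt | heq | hgt
    · exact Or.inl hlt
    · exact absurd heq.symm (h1 j)
    · exact Or.inr hgt
  have hBsum : ∑ j ∈ B, (Pi.single (τ j) (1 : ZMod 2) : V → ZMod 2) =
      ∑ j ∈ A, (Pi.single (τ (σ j)) (1 : ZMod 2) : V → ZMod 2) := by
    refine (Finset.sum_bij (fun j _ => σ j) (fun j hj => ?_) (fun j₁ _ j₂ _ h => σ.injective h)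
      (fun j hj => ?_) (fun j _ => rfl)).symm
    · rw [hA, Finset.mem_filter] at hj
      rw [hB, Finset.mem_filter, h2]
      exact ⟨Finset.mem_univ _, hj.2⟩
    · rw [hB, Finset.mem_filter] at hj
      refine ⟨σ j, ?_, h2 j⟩
      rw [hA, Finset.mem_filter, h2]
      exact ⟨Finset.mem_univ _, hj.2⟩
  have hsplit : (∑ j, Pi.single (τ j) (1 : ZMod 2) : V → ZMod 2) =
      ∑ j ∈ A, ((Pi.single (τ j) (1 : ZMod 2) : V → ZMod 2) + Pi.single (τ (σ j)) 1) := by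
    rw [Finset.sum_add_distrib, ← hBsum, ← Finset.sum_union hdisj, hunion]
  rw [hsplit]
  refine Submodule.sum_mem _ fun j _ => ?_
  exact (h3 j).elim fun W => single_add_single_mem_span_of_walk p q v W

/-! ### Span ⇒ even classes ⇒ pairing -/

/-- **Pairing ↔ span membership** (graphic `𝔽₂`-homology): the terminals admit a fixed-point-free pairing
through selected paths iff `Σ_j e_{τ j}` lies in the `𝔽₂`-span of the selected edge vectors. `←`: the
parity functional of a connectivity class kills every selected edge vector, hence the span, so every class
holds an even number of terminals, and `exists_perm_pairing_of_even_fibers` pairs them. [folklore] -/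
theorem pairing_iff_mem_span (p q : Fin n → V) (τ : Fin k → V) (v : Fin n → Bool) :
    (∃ σ : Equiv.Perm (Fin k), (∀ j, σ j ≠ j) ∧ (∀ j, σ (σ j) = j) ∧
      ∀ j, (SimpleGraph.fromRel fun a b : V => ∃ i, v i = true ∧ p i = a ∧ q i = b).Reachable (τ j) (τ (σ j))) ↔
    (∑ j, Pi.single (τ j) (1 : ZMod 2) : V → ZMod 2) ∈
      Submodule.span (ZMod 2) ((fun i => (Pi.single (p i) (1 : ZMod 2) + Pi.single (q i) 1 : V → ZMod 2)) ''
        {i | v i = true}) := by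
  classical
  constructor
  · rintro ⟨σ, h1, h2, h3⟩
    exact sum_single_mem_span_of_pairing p q τ v σ h1 h2 h3
  · intro hmem
    set G : SimpleGraph V := SimpleGraph.fromRel fun a b : V => ∃ i, v i = true ∧ p i = a ∧ q i = b with hG
    let cls : Fin k → G.ConnectedComponent := fun j => G.connectedComponentMk (τ j)
    -- every class holds an even number of terminals
    have heven : ∀ C, Even ((Finset.univ.filter fun j => cls j = C).card) := by
      intro C
      -- the parity functional of the class
      let φ : (V → ZMod 2) →ₗ[ZMod 2] ZMod 2 :=
        ∑ u ∈ Finset.univ.filter (fun u => G.connectedComponentMk u = C), LinearMap.proj u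
      have hφ : ∀ x : V → ZMod 2, φ x = ∑ u ∈ Finset.univ.filter (fun u => G.connectedComponentMk u = C), x u := by
        intro x
        simp only [φ, LinearMap.sum_apply, LinearMap.proj_apply]
      have hφsingle : ∀ a : V, φ (Pi.single a 1) = if G.connectedComponentMk a = C then 1 else 0 := by
        intro a
        rw [hφ]
        simp only [Pi.single_apply]
        rw [Finset.sum_ite_eq']
        simp only [Finset.mem_filter, Finset.mem_univ, true_and]
      -- it kills every selected edge vector, hence the span
      have hker : ∀ x ∈ Submodule.span (ZMod 2) ((fun i => (Pi.single (p i) (1 : ZMod 2) + Pi.single (q i) 1 :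
          V → ZMod 2)) '' {i | v i = true}), φ x = 0 := by
        intro x hx
        refine Submodule.span_induction (p := fun x _ => φ x = 0) ?_ (map_zero φ) (fun x y _ _ hx hy => by
          rw [map_add, hx, hy, add_zero]) (fun a x _ hx => by rw [map_smul, hx, smul_zero]) hx
        rintro _ ⟨i, hvi, rfl⟩
        have hsame : G.connectedComponentMk (p i) = G.connectedComponentMk (q i) := by
          by_cases hpq : p i = q i
          · rw [hpq]
          · exact SimpleGraph.ConnectedComponent.sound (SimpleGraph.Adj.reachable
              ((SimpleGraph.fromRel_adj _ _ _).2 ⟨hpq, Or.inl ⟨i, hvi, rfl, rfl⟩⟩))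
        rw [map_add, hφsingle, hφsingle, hsame]
        split_ifs <;> decide
      -- evaluate on `Σ_j e_{τ j}`
      have hval : φ (∑ j, Pi.single (τ j) (1 : ZMod 2)) =
          ((Finset.univ.filter fun j => cls j = C).card : ZMod 2) := by
        rw [map_sum]
        simp only [hφsingle]
        rw [Finset.sum_boole]
      have h0 := hker _ hmem
      rw [hval, ZMod.natCast_eq_zero_iff_even] at h0
      exact h0
    obtain ⟨σ, h1, h2, h3⟩ := exists_perm_pairing_of_even_fibers cls heven
    exact ⟨σ, h1, h2, fun j => (SimpleGraph.ConnectedComponent.eq.1 (h3 j)).symm⟩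

/-- **Graphic `𝔽₂`-span membership is ONE GRANK gate (registered sub-goal `graphicSpan_isGRankGate`).**
For an edge list `(p i, q i)` (the inputs) and terminals `τ : Fin k → V`, the monotone function
`v ↦ [Σ_j e_{τ j} ∈ span_{𝔽₂} {e_{p i} + e_{q i} : v i = 1}]` — the GRAPHIC slice of the abelian-PERM /
XOR-SAT door (`T`-join existence; Tseitin satisfiability by selected edges) — is a generic-rank threshold gate
of dimension `|V|(|V|+1)k + k`. [folklore] -/
theorem graphicSpan_isGRankGate : ∀ (V : Type) [Fintype V] [DecidableEq V] (n k : ℕ)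
    (p q : Fin n → V) (τ : Fin k → V) (f : (Fin n → Bool) → Bool),
    (∀ v, f v = true ↔ (∑ j, Pi.single (τ j) (1 : ZMod 2) : V → ZMod 2) ∈
      Submodule.span (ZMod 2) ((fun i => (Pi.single (p i) (1 : ZMod 2) + Pi.single (q i) 1 : V → ZMod 2)) ''
        {i | v i = true})) →
    IsGRankGate ((Fintype.card V * (Fintype.card V + 1)) * k + k) ⟨n, f⟩ := by
  intro V _ _ n k p q τ f hf
  exact pairConnected_isGRankGate V n k p q τ f fun v => (hf v).trans (pairing_iff_mem_span p q τ v).symm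

end

end Summit.PneNP.PneNP.Theorems.Capture.TJoin
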